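import Mathlib
import Summits.NavierStokesRegularity.NavierStokesRegularity.Theorems.TrappingWindowRungThreeTailEnvelopesTools
import Literature.Analysis.FluidPDE.Tao2016AveragedNS.ShiftSetCascadeFlux
import HarnessLib

/-!
# `TrappingWindowRungThree.TailEnvelopes` (item stmt-NavierStokesRegularity-21748, crux K2) — the BEHIND
  tail: one improvement step of the amplitude bootstrap

Route `TrappingWindowRungThree` (rung TL-M3 of the Tao ladder; MODEL lattice ODEs only — Tao 2016, §4
(4.8)–(4.10), cell vocabulary `TaoCascade.PseudoFlowOn`). BEHIND the window (`k < -Kb`) the couplings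
`2^{5k/2}` are tiny against the amplitude envelope `A_k = Cb 2^{(3/4)|k|}`. `behind_improve`: along an
`(η, η)`-pseudo-flow on `[0, t]` (`t ≤ c`) started under the envelope (`|S₀_{i,k}| ≤ A_k`, slack
`B₀_{i,k} ≤ A_k²`) with the bottom window shell under its sup bound `|S_{i,-Kb}| ≤ M_{-Kb}`, the bootstrap
assumption `|S_{i,k}| ≤ (6/5) A_k` on `[0, t]` (all `k < -Kb`) improves to `|S_{i,k}| ≤ (59/50) A_k` and
`F_{i,k} ≤ 2 A_k²`, provided PC1 (`c (68 Cb 2^{-(7/4)(Kb+1)} + 47 M_{-Kb} 2^{-(5/2)(Kb+1)}) ≤ 1/8`) and the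
defect budget `c η ≤ 2/15`: the shell-resolved size of the quadratic term (`abs_quadTerm_le_three_shell`)
is `≤ 2^{5k/2} A_k (68 A_k + 47 M_{-Kb})`, which PC1 turns into a drift `≤ A_k/8` over the clock; the
energy cap (4.9) gives `F ≤ (3/2 + 3/20) A_k²`, and the defect `η 4^k √F ≤ (3/8) η A_k` drifts by
`≤ A_k/20`; `1 + 1/8 + 1/20 < 59/50`.

HONEST FRAMING: bookkeeping about Tao-type MODEL lattice pseudo-flows; nothing here is a statement about
the Navier–Stokes equations; NS regularity is NOT proved by anything in this file.
-/

noncomputable section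

-- the sub-problem namespace repeats the summit name by design (D-0017)
set_option linter.dupNamespace false

namespace Summit.NavierStokesRegularity.NavierStokesRegularity.Theorems

open Set MeasureTheory intervalIntegral Literature.Analysis.FluidPDE
  Literature.Analysis.FluidPDE.TaoCascade GappedFrontRobust

namespace TailEnvelopes

/-! ### Numeric facts -/

/-- `2^{3/4} ≤ 17/10` (as `8 ≤ (17/10)^4`). [folklore] -/
theorem two_rpow_three_quarters_le : (2 : ℝ) ^ ((3 : ℝ) / 4) ≤ 17 / 10 := by
  have h0 : (0 : ℝ) ≤ (2 : ℝ) ^ ((3 : ℝ) / 4) := Real.rpow_nonneg zero_le_two _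
  have h4 : ((2 : ℝ) ^ ((3 : ℝ) / 4)) ^ 4 = 8 := by
    rw [← Real.rpow_natCast, ← Real.rpow_mul zero_le_two]
    norm_num
  by_contra hle
  push Not at hle
  have := pow_lt_pow_left₀ hle (by norm_num) (by norm_num : (4 : ℕ) ≠ 0)
  rw [h4] at this
  norm_num at this

/-- `2^{-3/4} ≤ 3/5` (as `(2^{-3/4})^4 = 1/8 ≤ (3/5)^4`). [folklore] -/
theorem two_rpow_neg_three_quarters_le : (2 : ℝ) ^ (-(3 : ℝ) / 4) ≤ 3 / 5 := by
  have h0 : (0 : ℝ) ≤ (2 : ℝ) ^ (-(3 : ℝ) / 4) := Real.rpow_nonneg zero_le_two _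
  have h4 : ((2 : ℝ) ^ (-(3 : ℝ) / 4)) ^ 4 = 1 / 8 := by
    rw [← Real.rpow_natCast, ← Real.rpow_mul zero_le_two]
    norm_num
  by_contra hle
  push Not at hle
  have := pow_lt_pow_left₀ hle (by norm_num) (by norm_num : (4 : ℕ) ≠ 0)
  rw [h4] at this
  norm_num at this

/-- `2^{-5/2} ≤ 9/50` (as `(2^{-5/2})² = 1/32 ≤ (9/50)²`). [folklore] -/
theorem two_rpow_neg_five_halves_le : (2 : ℝ) ^ (-(5 : ℝ) / 2) ≤ 9 / 50 := by
  have h0 : (0 : ℝ) ≤ (2 : ℝ) ^ (-(5 : ℝ) / 2) := Real.rpow_nonneg zero_le_two _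
  have h4 : ((2 : ℝ) ^ (-(5 : ℝ) / 2)) ^ 2 = 1 / 32 := by
    rw [← Real.rpow_natCast, ← Real.rpow_mul zero_le_two]
    norm_num
  by_contra hle
  push Not at hle
  have := pow_lt_pow_left₀ hle (by norm_num) (by norm_num : (2 : ℕ) ≠ 0)
  rw [h4] at this
  norm_num at this

/-! ### One improvement step behind the window -/

variable {t η : ℝ} {α : Fin 4 → Fin 4 → Fin 4 → ℤ × ℤ × ℤ → ℝ}
  {S₀ F₀ B₀ : Fin 4 → ℤ → ℝ} {S F : Fin 4 → ℤ → ℝ → ℝ}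

/-- **One improvement step of the behind bootstrap** (see the module docstring): under PC1, the defect
budget `c η ≤ 2/15`, the start bounds `|S₀_{i,k}| ≤ A_k`, `B₀_{i,k} ≤ A_k²` (`k < -Kb`,
`A_k = Cb 2^{(3/4)(-k)}`), the bottom window bound `|S_{i,-Kb}| ≤ M_{-Kb}` and the bootstrap assumption
`|S_{i,k}| ≤ (6/5) A_k` on `[0, t]` (`0 < t ≤ c`), every behind shell obeys `|S_{i,k}| ≤ (59/50) A_k` and
`F_{i,k} ≤ 2 A_k²` on `[0, t]`. [cite: Tao2016AveragedNS, §4 Lemma 4.1 (4.8)–(4.10)] -/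
theorem behind_improve (h : PseudoFlowOn t 1 α η η S₀ F₀ B₀ S F) (ht : 0 < t)
    {c Cb Mb : ℝ} {Kb : ℤ} (htc : t ≤ c) (hη : 0 ≤ η)
    (hα1 : ∀ (i₁ i₂ i₃ : Fin 4) (μ : ℤ × ℤ × ℤ), μ ∈ shiftSet → |α i₁ i₂ i₃ μ| ≤ 1)
    (hCb : 0 < Cb) (hKb : 0 ≤ Kb)
    (hPC1 : c * (68 * Cb * (2 : ℝ) ^ (-(7 : ℝ) / 4 * ((Kb : ℝ) + 1)) +
      47 * Mb * (2 : ℝ) ^ (-(5 : ℝ) / 2 * ((Kb : ℝ) + 1))) ≤ 1 / 8)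
    (hηc : c * η ≤ 2 / 15)
    (hS₀ : ∀ i k, k < -Kb → |S₀ i k| ≤ Cb * (2 : ℝ) ^ ((3 : ℝ) / 4 * (-(k : ℝ))))
    (hB₀ : ∀ i k, k < -Kb → B₀ i k ≤ (Cb * (2 : ℝ) ^ ((3 : ℝ) / 4 * (-(k : ℝ)))) ^ 2)
    (hwin : ∀ i, ∀ s ∈ Icc 0 t, |S i (-Kb) s| ≤ Mb)
    (hyp : ∀ i k, k < -Kb → ∀ u ∈ Icc 0 t, |S i k u| ≤ 6 / 5 * (Cb * (2 : ℝ) ^ ((3 : ℝ) / 4 * (-(k : ℝ))))) :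
    ∀ i k, k < -Kb → ∀ u ∈ Icc 0 t,
      |S i k u| ≤ 59 / 50 * (Cb * (2 : ℝ) ^ ((3 : ℝ) / 4 * (-(k : ℝ)))) ∧
        F i k u ≤ 2 * (Cb * (2 : ℝ) ^ ((3 : ℝ) / 4 * (-(k : ℝ)))) ^ 2 := by
  set A : ℤ → ℝ := fun k => Cb * (2 : ℝ) ^ ((3 : ℝ) / 4 * (-(k : ℝ))) with hA
  have h2 : (1 + 1 : ℝ) = 2 := one_add_one_eq_two
  have hc : 0 < c := ht.trans_le htc
  have hApos : ∀ k, 0 < A k := fun k => mul_pos hCb (Real.rpow_pos_of_pos two_pos _)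
  have hMb : 0 ≤ Mb := (abs_nonneg _).trans (hwin 0 0 ⟨le_rfl, ht.le⟩)
  -- envelope shifts
  have hAdn : ∀ k : ℤ, A (k - 1) = (2 : ℝ) ^ ((3 : ℝ) / 4) * A k := by
    intro k; simp only [hA]
    rw [mul_left_comm, ← Real.rpow_add two_pos]; push_cast; ring_nf
  have hAup : ∀ k : ℤ, A (k + 1) = (2 : ℝ) ^ (-(3 : ℝ) / 4) * A k := by
    intro k; simp only [hA]
    rw [mul_left_comm, ← Real.rpow_add two_pos]; push_cast; ring_nf
  have h17 := two_rpow_three_quarters_le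
  have h35 := two_rpow_neg_three_quarters_le
  have h950 := two_rpow_neg_five_halves_le
  intro i k hk u hu
  have hk1 : k ≤ -1 := by omega
  have hAk := hApos k
  set P : ℝ := (2 : ℝ) ^ ((5 : ℝ) * (k : ℝ) / 2) with hP
  have hP0 : 0 < P := Real.rpow_pos_of_pos two_pos _
  -- three-shell amplitude bounds on [0, t]
  have ha : ∀ v ∈ Icc 0 t, ∀ j, |S j (k - 1) v| ≤ 51 / 25 * A k := by
    intro v hv j
    have h1 := hyp j (k - 1) (by omega) v hv
    have h1' : |S j (k - 1) v| ≤ 6 / 5 * A (k - 1) := h1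
    rw [hAdn] at h1'
    have : (2 : ℝ) ^ ((3 : ℝ) / 4) * A k ≤ 17 / 10 * A k := mul_le_mul_of_nonneg_right h17 hAk.le
    linarith
  have hb : ∀ v ∈ Icc 0 t, ∀ j, |S j k v| ≤ 6 / 5 * A k := fun v hv j => hyp j k hk v hv
  have hd : ∀ v ∈ Icc 0 t, ∀ j, |S j (k + 1) v| ≤ 18 / 25 * A k + Mb := by
    intro v hv j
    rcases lt_or_eq_of_le (show k + 1 ≤ -Kb by omega) with hlt | heq
    · have h1 : |S j (k + 1) v| ≤ 6 / 5 * A (k + 1) := hyp j (k + 1) hlt v hv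
      rw [hAup] at h1
      have : (2 : ℝ) ^ (-(3 : ℝ) / 4) * A k ≤ 3 / 5 * A k := mul_le_mul_of_nonneg_right h35 hAk.le
      linarith
    · rw [heq]
      have := hwin j v hv
      linarith
  -- the size of the quadratic term on [0, t]
  set D : ℝ := P * A k * (68 * A k + 47 * Mb) with hD
  have hD0 : 0 ≤ D := by positivity
  have hqT : ∀ v ∈ Icc 0 t, |quadTerm 1 α S i k v| ≤ D := by
    intro v hv
    have h1 := abs_quadTerm_le_three_shell (ε₀ := (1 : ℝ)) (by norm_num) α hα1 S i k v
      (ha v hv) (hb v hv) (hd v hv)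
    rw [h2] at h1
    have hcast : ((5 : ℝ) * ((k - 1 : ℤ) : ℝ) / 2) = (5 : ℝ) * (k : ℝ) / 2 + (-(5 : ℝ) / 2) := by
      push_cast; ring
    rw [hcast, Real.rpow_add two_pos] at h1
    refine h1.trans ?_
    rw [← hP, hD]
    have hP' : P * (2 : ℝ) ^ (-(5 : ℝ) / 2) ≤ P * (9 / 50) := mul_le_mul_of_nonneg_left h950 hP0.le
    have hsq : 0 ≤ 51 / 25 * A k * (51 / 25 * A k) := by positivity
    have h3 := mul_le_mul_of_nonneg_right hP' hsq
    push_cast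
    nlinarith [mul_nonneg hP0.le hAk.le, mul_nonneg (mul_nonneg hP0.le hAk.le) hMb,
      mul_nonneg (mul_nonneg hP0.le hAk.le) hAk.le]
  -- PC1 turns the drift over the clock into A_k / 8
  have hcD : c * D ≤ A k / 8 := by
    have hk' : (k : ℝ) ≤ -((Kb : ℝ) + 1) := by
      have : (k : ℝ) ≤ ((-Kb - 1 : ℤ) : ℝ) := by exact_mod_cast (show k ≤ -Kb - 1 by omega)
      push_cast at this; linarith
    have hX : P * (2 : ℝ) ^ ((3 : ℝ) / 4 * (-(k : ℝ))) ≤ (2 : ℝ) ^ (-(7 : ℝ) / 4 * ((Kb : ℝ) + 1)) := by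
      rw [hP, ← Real.rpow_add two_pos]
      exact Real.rpow_le_rpow_of_exponent_le one_le_two (by linarith)
    have hY : P ≤ (2 : ℝ) ^ (-(5 : ℝ) / 2 * ((Kb : ℝ) + 1)) :=
      Real.rpow_le_rpow_of_exponent_le one_le_two (by linarith)
    have e1 : c * D = A k * (c * (68 * Cb * (P * (2 : ℝ) ^ ((3 : ℝ) / 4 * (-(k : ℝ)))) + 47 * Mb * P)) := by
      simp only [hD, hA]; ring
    rw [e1]
    have h1 : 68 * Cb * (P * (2 : ℝ) ^ ((3 : ℝ) / 4 * (-(k : ℝ)))) ≤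
        68 * Cb * (2 : ℝ) ^ (-(7 : ℝ) / 4 * ((Kb : ℝ) + 1)) := mul_le_mul_of_nonneg_left hX (by positivity)
    have h3 : 47 * Mb * P ≤ 47 * Mb * (2 : ℝ) ^ (-(5 : ℝ) / 2 * ((Kb : ℝ) + 1)) :=
      mul_le_mul_of_nonneg_left hY (by positivity)
    have h4 : c * (68 * Cb * (P * (2 : ℝ) ^ ((3 : ℝ) / 4 * (-(k : ℝ)))) + 47 * Mb * P) ≤ 1 / 8 := by
      have := mul_le_mul_of_nonneg_left (add_le_add h1 h3) hc.le
      linarith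
    have := mul_le_mul_of_nonneg_left h4 hAk.le
    linarith
  -- the energy on [0, t]
  have hF : ∀ v ∈ Icc 0 t, F i k v ≤ 2 * A k ^ 2 := by
    intro v hv
    have hF₀ : F₀ i k ≤ 3 / 2 * A k ^ 2 := by
      have h0 := h.defect_upper i k 0 ⟨le_rfl, ht.le⟩
      rw [intervalIntegral.integral_same, mul_zero, add_zero, h.init_S, h.init_F] at h0
      have hS0 := hS₀ i k hk
      have hsq : S₀ i k ^ 2 ≤ A k ^ 2 := by
        rw [← sq_abs]; exact pow_le_pow_left₀ (abs_nonneg _) hS0 2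
      have hB := hB₀ i k hk
      have : B₀ i k ≤ A k ^ 2 := hB
      linarith
    have hcap := h.toShift.energy_cap ht i k hv
    simp only [quadTermOn_shiftSet] at hcap
    have hint : ∫ w in (0 : ℝ)..v, quadTerm 1 α S i k w * S i k w ≤ c * (D * (6 / 5 * A k)) := by
      have hle : ∀ w ∈ Set.uIoc (0 : ℝ) v, ‖quadTerm 1 α S i k w * S i k w‖ ≤ D * (6 / 5 * A k) := by
        intro w hw
        rw [uIoc_of_le hv.1] at hw
        have hw' : w ∈ Icc 0 t := ⟨hw.1.le, hw.2.trans hv.2⟩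
        rw [Real.norm_eq_abs, abs_mul]
        exact mul_le_mul (hqT w hw') (hb w hw' i) (abs_nonneg _) hD0
      have h1 := intervalIntegral.norm_integral_le_of_norm_le_const hle
      rw [Real.norm_eq_abs, sub_zero, abs_of_nonneg hv.1] at h1
      have h3 : D * (6 / 5 * A k) * v ≤ D * (6 / 5 * A k) * c :=
        mul_le_mul_of_nonneg_left (hv.2.trans htc) (by positivity)
      linarith [le_abs_self (∫ w in (0 : ℝ)..v, quadTerm 1 α S i k w * S i k w)]
    have h5 : c * (D * (6 / 5 * A k)) ≤ A k / 8 * (6 / 5 * A k) := by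
      have := mul_le_mul_of_nonneg_right hcD (by positivity : 0 ≤ 6 / 5 * A k)
      linarith
    nlinarith
  refine ⟨?_, hF u hu⟩
  -- the amplitude drift on [0, t]
  have hq4 := two_rpow_two_mul_le_quarter hk1
  set L : ℝ := D + η * (1 / 4) * (3 / 2 * A k) with hL
  have hLbd : ∀ v ∈ Icc 0 t,
      |quadTerm 1 α S i k v| + η * (1 + 1 : ℝ) ^ ((2 : ℝ) * (k : ℝ)) * Real.sqrt (F i k v) ≤ L := by
    intro v hv
    rw [h2]
    have hsq : Real.sqrt (F i k v) ≤ 3 / 2 * A k := by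
      rw [Real.sqrt_le_iff]
      refine ⟨by positivity, ?_⟩
      nlinarith [hF v hv]
    have h1 : η * (2 : ℝ) ^ ((2 : ℝ) * (k : ℝ)) * Real.sqrt (F i k v) ≤ η * (1 / 4) * (3 / 2 * A k) :=
      mul_le_mul (mul_le_mul_of_nonneg_left hq4 hη) hsq (Real.sqrt_nonneg _) (by positivity)
    linarith [hqT v hv]
  have hdrift := pseudoFlowOn_abs_sub_le h i k hLbd ⟨le_rfl, ht.le⟩ hu
  rw [sub_zero, abs_of_nonneg hu.1, h.init_S] at hdrift
  have hS0 := hS₀ i k hk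
  have hLc : L * u ≤ A k / 8 + 1 / 20 * A k := by
    have hL0 : 0 ≤ L := by positivity
    have h1 : L * u ≤ L * c := mul_le_mul_of_nonneg_left (hu.2.trans htc) hL0
    have h3 : L * c = c * D + c * η * (3 / 8 * A k) := by rw [hL]; ring
    have h4 : c * η * (3 / 8 * A k) ≤ 2 / 15 * (3 / 8 * A k) :=
      mul_le_mul_of_nonneg_right hηc (by positivity)
    linarith
  have htri : |S i k u| ≤ |S₀ i k| + |S i k u - S₀ i k| := by
    have := abs_add_le (S₀ i k) (S i k u - S₀ i k); simpa using this
  change |S i k u| ≤ 59 / 50 * A k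
  linarith
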